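import Mathlib.Analysis.InnerProductSpace.GramSchmidtOrtho
import Mathlib.Analysis.InnerProductSpace.PiL2
import HarnessLib

/-!
# Quantitative Gram–Schmidt and Euclidean almost-isometries

§1. **Quantitative Gram–Schmidt.** If `f₀, …, f_{n-1}` in a real inner product space have Gram
matrix `η`-close to the identity, `|⟪fᵢ, fⱼ⟫ - δᵢⱼ| ≤ η` with `η ≤ 1/(2 (7n)ⁿ)`, then the
Gram–Schmidt orthonormalization moves each vector by at most `(7n)ⁱ η`:
`‖gramSchmidtNormed f i - fᵢ‖ ≤ (7n)ⁱ η` (`norm_gramSchmidtNormed_sub_le`), and in dimension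
`n` the Gram–Schmidt orthonormal basis is `(7n)ⁿ η`-close to `f`
(`exists_orthonormalBasis_near`).

§2. **Almost isometries of the Euclidean unit ball are close to isometries** (the folklore
lemma behind Reifenberg-type and Gromov–Hausdorff-approximation arguments, e.g.
Cheeger–Colding 1997, Appendix 1; Colding 1997, *Ricci curvature and volume convergence*, §1):
if `f : ℝⁿ → ℝⁿ` distorts distances on the closed unit ball by at most `δ ≤ δ₀(n)`, then there
is a linear isometry `A` with `‖f x - (f 0 + A x)‖ ≤ C(n) δ` on the ball
(`exists_linearIsometryEquiv_near_of_abs_norm_sub_le`), with explicit `δ₀(n) = 1/(12 (7n)ⁿ)`,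
`C(n) = n (6 + 11 (7n)ⁿ)`. Proof: polarization turns the distortion bound into an `11δ/2`-almost
orthonormal frame `f(eᵢ) - f(0)` and `11δ/2`-almost correct coordinates `⟪f x - f 0, f eᵢ - f 0⟫`;
§1 straightens the frame. §3: the scaled version on balls of radius `r` and the propagation
of affine closeness (`norm_affine_sub_affine_le`). Everything is proved; no definitions, no
named facts (D-0026).
Groundwork for `CheegerColding1997_sphereStability` (Reifenberg method, CC97 Thm. A.1.2–A.1.3).

## References

* J. Cheeger, T. H. Colding, J. Differential Geom. 46 (1997) 406–480, Appendix 1. [CheegerColding1997]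
* T. H. Colding, Ann. of Math. 145 (1997) 477–501, §1.
* P. Alestalo, D. A. Trotsenko, J. Väisälä, *Isometric approximation*, Israel J. Math. 125 (2001).
-/

noncomputable section

open Finset InnerProductSpace
open scoped RealInnerProductSpace

namespace Literature.Geometry.Euclidean

variable {E : Type*} [NormedAddCommGroup E] [InnerProductSpace ℝ E]

/-! ### §1 Quantitative Gram–Schmidt -/

omit [InnerProductSpace ℝ E] in
/-- `|‖v‖ - 1| ≤ |‖v‖² - 1|`. [folklore] -/
theorem abs_norm_sub_one_le (v : E) : |‖v‖ - 1| ≤ |‖v‖ ^ 2 - 1| := by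
  have h : ‖v‖ ^ 2 - 1 = (‖v‖ - 1) * (‖v‖ + 1) := by ring
  rw [h, abs_mul]
  have h1 : 1 ≤ |‖v‖ + 1| := by rw [abs_of_nonneg (by positivity)]; linarith [norm_nonneg v]
  calc |‖v‖ - 1| = |‖v‖ - 1| * 1 := (mul_one _).symm
    _ ≤ |‖v‖ - 1| * |‖v‖ + 1| := mul_le_mul_of_nonneg_left h1 (abs_nonneg _)

/-- The norm of the Gram–Schmidt projection term: for `g ≠ 0`,
`‖(⟪g, x⟫/‖g‖²) • g‖ = |⟪‖g‖⁻¹ • g, x⟫|`. [folklore] -/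
theorem norm_inner_div_sq_smul {g : E} (hg : g ≠ 0) (x : E) :
    ‖(⟪g, x⟫ / ‖g‖ ^ 2) • g‖ = |⟪‖g‖⁻¹ • g, x⟫| := by
  have hn : 0 < ‖g‖ := norm_pos_iff.2 hg
  rw [norm_smul, Real.norm_eq_abs, real_inner_smul_left, abs_div, abs_mul, abs_inv,
    abs_of_pos hn, abs_of_pos (pow_pos hn 2)]
  field_simp

/-- **Quantitative Gram–Schmidt** (by strong induction along the process): if
`|⟪fᵢ, fⱼ⟫ - δᵢⱼ| ≤ η` for all `i, j < n` and `0 ≤ η ≤ 1/(2(7n)ⁿ)`, then every Gram–Schmidt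
vector is nonzero and `‖gramSchmidtNormed ℝ f i - fᵢ‖ ≤ (7n)ⁱ η`. [folklore] -/
theorem norm_gramSchmidtNormed_sub_le {n : ℕ} (f : Fin n → E) {η : ℝ} (hη0 : 0 ≤ η)
    (hη : η ≤ 1 / (2 * (7 * n : ℝ) ^ n))
    (hG : ∀ i j : Fin n, |⟪f i, f j⟫ - (if i = j then 1 else 0)| ≤ η) :
    ∀ k : Fin n, gramSchmidt ℝ f k ≠ 0 ∧
      ‖gramSchmidtNormed ℝ f k - f k‖ ≤ (7 * n : ℝ) ^ (k : ℕ) * η := by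
  -- basic sizes
  have hn : 0 < n ∨ n = 0 := by omega
  set N : ℝ := 7 * n with hN
  -- strong induction on `k`
  suffices H : ∀ m : ℕ, ∀ k : Fin n, (k : ℕ) = m → gramSchmidt ℝ f k ≠ 0 ∧
      ‖gramSchmidtNormed ℝ f k - f k‖ ≤ N ^ (k : ℕ) * η from fun k ↦ H k k rfl
  intro m
  induction m using Nat.strong_induction_on with
  | _ m IH =>
  intro k hkm
  have hn0 : 0 < n := lt_of_le_of_lt (Nat.zero_le _) k.2
  have hN7 : (7 : ℝ) ≤ N := by
    rw [hN]; have : (1 : ℝ) ≤ n := by exact_mod_cast hn0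
    linarith
  have hN1 : (1 : ℝ) ≤ N := by linarith
  have hNn : (1 : ℝ) ≤ N ^ n := one_le_pow₀ hN1
  have hηs : η * N ^ n ≤ 1 / 2 := by
    have h1 : 0 < 2 * N ^ n := by positivity
    calc η * N ^ n ≤ 1 / (2 * N ^ n) * N ^ n := mul_le_mul_of_nonneg_right hη (by positivity)
      _ = 1 / 2 := by field_simp
  have hη1 : η ≤ 1 / 14 := by
    have : η * 7 ≤ η * N ^ n := mul_le_mul_of_nonneg_left (hN7.trans (by
      calc N = N ^ 1 := (pow_one N).symm
        _ ≤ N ^ n := pow_le_pow_right₀ hN1 hn0)) hη0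
    linarith
  -- norms of the `f i`
  have hnorm : ∀ i, |‖f i‖ - 1| ≤ η := fun i ↦ by
    have h := hG i i
    simp only [if_true] at h
    rw [real_inner_self_eq_norm_sq] at h
    exact (abs_norm_sub_one_le (f i)).trans h
  have hnorm2 : ∀ i, ‖f i‖ ≤ 2 := fun i ↦ by
    have := abs_le.1 (hnorm i); linarith
  -- the induction hypothesis at `i < k`
  have IH' : ∀ i : Fin n, i < k → gramSchmidt ℝ f i ≠ 0 ∧
      ‖gramSchmidtNormed ℝ f i - f i‖ ≤ N ^ (i : ℕ) * η := fun i hi ↦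
    IH i (by rw [← hkm]; exact hi) i rfl
  -- the projection terms
  have hterm : ∀ i ∈ Iio k,
      ‖(⟪gramSchmidt ℝ f i, f k⟫ / ‖gramSchmidt ℝ f i‖ ^ 2) • gramSchmidt ℝ f i‖ ≤
        3 * η * N ^ (k : ℕ) / N := by
    intro i hi
    rw [mem_Iio] at hi
    obtain ⟨hi0, hib⟩ := IH' i hi
    rw [norm_inner_div_sq_smul hi0]
    have hgn : gramSchmidtNormed ℝ f i = ‖gramSchmidt ℝ f i‖⁻¹ • gramSchmidt ℝ f i := by
      rw [gramSchmidtNormed, RCLike.ofReal_real_eq_id, id]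
    rw [← hgn]
    -- `⟪ĝ_i, f k⟫ = ⟪f i, f k⟫ + ⟪ĝ_i - f i, f k⟫`
    have h1 : ⟪gramSchmidtNormed ℝ f i, f k⟫ = ⟪f i, f k⟫ + ⟪gramSchmidtNormed ℝ f i - f i, f k⟫ := by
      rw [inner_sub_left]; ring
    have h2 : |⟪f i, f k⟫| ≤ η := by
      have h := hG i k
      rwa [if_neg hi.ne, sub_zero] at h
    have h3 : |⟪gramSchmidtNormed ℝ f i - f i, f k⟫| ≤ N ^ (i : ℕ) * η * 2 :=
      (abs_real_inner_le_norm _ _).trans (mul_le_mul hib (hnorm2 k) (norm_nonneg _)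
        (by positivity))
    have h4 : N ^ (i : ℕ) * N ≤ N ^ (k : ℕ) := by
      rw [← pow_succ]; exact pow_le_pow_right₀ hN1 (by exact_mod_cast hi)
    have hNpos : 0 < N := by linarith
    rw [h1]
    calc |⟪f i, f k⟫ + ⟪gramSchmidtNormed ℝ f i - f i, f k⟫|
        ≤ |⟪f i, f k⟫| + |⟪gramSchmidtNormed ℝ f i - f i, f k⟫| := abs_add_le _ _
      _ ≤ η + N ^ (i : ℕ) * η * 2 := add_le_add h2 h3
      _ ≤ 3 * η * N ^ (i : ℕ) := by nlinarith [one_le_pow₀ (n := (i : ℕ)) hN1]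
      _ = 3 * η * (N ^ (i : ℕ) * N) / N := by field_simp
      _ ≤ 3 * η * N ^ (k : ℕ) / N := by gcongr
  -- `‖g_k - f_k‖ ≤ D`
  set D : ℝ := (k : ℕ) * (3 * η * N ^ (k : ℕ) / N) with hD
  have hgf : ‖gramSchmidt ℝ f k - f k‖ ≤ D := by
    have hdef := gramSchmidt_def'' ℝ f k
    have heq : gramSchmidt ℝ f k - f k =
        -∑ i ∈ Iio k, (⟪gramSchmidt ℝ f i, f k⟫ / ‖gramSchmidt ℝ f i‖ ^ 2) • gramSchmidt ℝ f i := by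
      have : ∀ i, ((RCLike.ofReal ‖gramSchmidt ℝ f i‖ : ℝ)) = ‖gramSchmidt ℝ f i‖ := fun i ↦ rfl
      conv_lhs => rw [hdef]
      simp only [this]
      abel
    rw [heq, norm_neg]
    calc ‖∑ i ∈ Iio k, (⟪gramSchmidt ℝ f i, f k⟫ / ‖gramSchmidt ℝ f i‖ ^ 2) • gramSchmidt ℝ f i‖
        ≤ ∑ i ∈ Iio k, ‖(⟪gramSchmidt ℝ f i, f k⟫ / ‖gramSchmidt ℝ f i‖ ^ 2) • gramSchmidt ℝ f i‖ :=
          norm_sum_le _ _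
      _ ≤ ∑ _i ∈ Iio k, 3 * η * N ^ (k : ℕ) / N := sum_le_sum hterm
      _ = D := by rw [sum_const, Fin.card_Iio, nsmul_eq_mul]
  -- size of `D`: `D ≤ (3/7) η N^k` and `D ≤ 3/14`
  have hNpos : 0 < N := by linarith
  have hkn : ((k : ℕ) : ℝ) ≤ n := by exact_mod_cast k.2.le
  have hD1 : D ≤ 3 / 7 * η * N ^ (k : ℕ) := by
    rw [hD]
    have h1 : ((k : ℕ) : ℝ) / N ≤ 1 / 7 := by
      rw [div_le_div_iff₀ hNpos (by norm_num : (0 : ℝ) < 7), hN]; linarith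
    have h2 : ((k : ℕ) : ℝ) * (3 * η * N ^ (k : ℕ) / N) = ((k : ℕ) / N) * (3 * η * N ^ (k : ℕ)) := by
      field_simp
    rw [h2]
    calc ((k : ℕ) : ℝ) / N * (3 * η * N ^ (k : ℕ)) ≤ 1 / 7 * (3 * η * N ^ (k : ℕ)) :=
          mul_le_mul_of_nonneg_right h1 (by positivity)
      _ = 3 / 7 * η * N ^ (k : ℕ) := by ring
  have hNk : η * N ^ (k : ℕ) ≤ 1 / 2 := by
    calc η * N ^ (k : ℕ) ≤ η * N ^ n :=
          mul_le_mul_of_nonneg_left (pow_le_pow_right₀ hN1 k.2.le) hη0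
      _ ≤ 1 / 2 := hηs
  have hD2 : D ≤ 3 / 14 := by nlinarith
  have hD0 : 0 ≤ D := by rw [hD]; positivity
  -- `‖g_k‖ ≥ 1 - η - D > 0`
  have hgk : 1 - η - D ≤ ‖gramSchmidt ℝ f k‖ := by
    have h1 : ‖f k‖ - ‖gramSchmidt ℝ f k - f k‖ ≤ ‖gramSchmidt ℝ f k‖ := by
      have := norm_sub_norm_le (f k) (gramSchmidt ℝ f k)
      rw [norm_sub_rev] at this; linarith
    have h2 := abs_le.1 (hnorm k)
    linarith
  have hgk0 : gramSchmidt ℝ f k ≠ 0 := by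
    rw [← norm_pos_iff]; linarith
  refine ⟨hgk0, ?_⟩
  -- `‖ĝ_k - f_k‖ ≤ |1 - ‖g_k‖| + D ≤ η + 2D`
  have hgn : gramSchmidtNormed ℝ f k = ‖gramSchmidt ℝ f k‖⁻¹ • gramSchmidt ℝ f k := by
    rw [gramSchmidtNormed, RCLike.ofReal_real_eq_id, id]
  have hpos : 0 < ‖gramSchmidt ℝ f k‖ := norm_pos_iff.2 hgk0
  have h1 : ‖gramSchmidtNormed ℝ f k - gramSchmidt ℝ f k‖ = |1 - ‖gramSchmidt ℝ f k‖| := by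
    rw [hgn, show ‖gramSchmidt ℝ f k‖⁻¹ • gramSchmidt ℝ f k - gramSchmidt ℝ f k =
      (‖gramSchmidt ℝ f k‖⁻¹ - 1) • gramSchmidt ℝ f k by rw [sub_smul, one_smul], norm_smul,
      Real.norm_eq_abs]
    rw [show ‖gramSchmidt ℝ f k‖⁻¹ - 1 = (1 - ‖gramSchmidt ℝ f k‖) * ‖gramSchmidt ℝ f k‖⁻¹ by
      field_simp, abs_mul, abs_inv, abs_of_pos hpos, mul_assoc, inv_mul_cancel₀ hpos.ne', mul_one]
  have h2 : |1 - ‖gramSchmidt ℝ f k‖| ≤ η + D := by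
    have h3 : ‖gramSchmidt ℝ f k‖ ≤ ‖f k‖ + ‖gramSchmidt ℝ f k - f k‖ := by
      have := norm_add_le (f k) (gramSchmidt ℝ f k - f k)
      rwa [add_sub_cancel] at this
    have h4 := abs_le.1 (hnorm k)
    rw [abs_le]; constructor <;> linarith
  have h5 : ‖gramSchmidtNormed ℝ f k - f k‖ ≤ η + 2 * D := by
    calc ‖gramSchmidtNormed ℝ f k - f k‖
        ≤ ‖gramSchmidtNormed ℝ f k - gramSchmidt ℝ f k‖ + ‖gramSchmidt ℝ f k - f k‖ :=
          norm_sub_le_norm_sub_add_norm_sub _ _ _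
      _ ≤ (η + D) + D := by rw [h1]; exact add_le_add h2 hgf
      _ = η + 2 * D := by ring
  -- `η + 2D ≤ N^k η`
  rcases Nat.eq_zero_or_pos (k : ℕ) with hk0 | hkpos
  · -- `k = 0`: `D = 0`
    have hD00 : D = 0 := by rw [hD, hk0]; simp
    rw [hD00, mul_zero, add_zero] at h5
    rw [hk0, pow_zero, one_mul]; exact h5
  · have h6 : (1 : ℝ) ≤ 1 / 7 * N ^ (k : ℕ) := by
      have : N ≤ N ^ (k : ℕ) := by
        calc N = N ^ 1 := (pow_one N).symm
          _ ≤ N ^ (k : ℕ) := pow_le_pow_right₀ hN1 hkpos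
      linarith
    calc ‖gramSchmidtNormed ℝ f k - f k‖ ≤ η + 2 * D := h5
      _ ≤ η * (1 / 7 * N ^ (k : ℕ)) + 2 * (3 / 7 * η * N ^ (k : ℕ)) := by
          have := mul_le_mul_of_nonneg_left h6 hη0
          linarith
      _ = N ^ (k : ℕ) * η := by ring

/-- **An orthonormal basis close to an almost orthonormal frame**: in an `n`-dimensional real
inner product space, vectors `f₀, …, f_{n-1}` with `|⟪fᵢ, fⱼ⟫ - δᵢⱼ| ≤ η ≤ 1/(2(7n)ⁿ)` are
`(7n)ⁿ η`-close to an orthonormal basis (the Gram–Schmidt basis). [folklore] -/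
theorem exists_orthonormalBasis_near {n : ℕ} [FiniteDimensional ℝ E]
    (hdim : Module.finrank ℝ E = n) (f : Fin n → E) {η : ℝ} (hη0 : 0 ≤ η)
    (hη : η ≤ 1 / (2 * (7 * n : ℝ) ^ n))
    (hG : ∀ i j : Fin n, |⟪f i, f j⟫ - (if i = j then 1 else 0)| ≤ η) :
    ∃ b : OrthonormalBasis (Fin n) ℝ E, ∀ i, ‖b i - f i‖ ≤ (7 * n : ℝ) ^ n * η := by
  have hcard : Module.finrank ℝ E = Fintype.card (Fin n) := by rw [hdim, Fintype.card_fin]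
  refine ⟨gramSchmidtOrthonormalBasis hcard f, fun i ↦ ?_⟩
  obtain ⟨hi0, hib⟩ := norm_gramSchmidtNormed_sub_le f hη0 hη hG i
  have hne : gramSchmidtNormed ℝ f i ≠ 0 := by
    intro h
    have h1 := gramSchmidtNormed_unit_length' (𝕜 := ℝ) (f := f) (n := i)
    rw [gramSchmidtNormed, RCLike.ofReal_real_eq_id, id, smul_eq_zero] at h
    rcases h with h | h
    · exact hi0 (norm_eq_zero.1 (inv_eq_zero.1 h))
    · exact hi0 h
  rw [gramSchmidtOrthonormalBasis_apply hcard hne]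
  refine hib.trans (mul_le_mul_of_nonneg_right ?_ hη0)
  have hn0 : 0 < n := lt_of_le_of_lt (Nat.zero_le _) i.2
  have h1 : (1 : ℝ) ≤ n := by exact_mod_cast hn0
  exact pow_le_pow_right₀ (by linarith) i.2.le

/-! ### §2 Almost isometries of the Euclidean unit ball -/

section NearIsometry

/-- Polarization transfers a distance-distortion bound to inner products: if `g 0 = 0` and
`|‖g x - g y‖ - ‖x - y‖| ≤ δ ≤ 1` for `x, y` in the closed unit ball (with `y = 0` allowed),
then `|⟪g x, g y⟫ - ⟪x, y⟫| ≤ 11δ/2` there. [folklore] -/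
theorem abs_inner_sub_inner_le_of_abs_norm_sub_le {g : E → E} {δ : ℝ} (hδ1 : δ ≤ 1)
    (hg0 : g 0 = 0)
    (hg : ∀ x y : E, ‖x‖ ≤ 1 → ‖y‖ ≤ 1 → |‖g x - g y‖ - ‖x - y‖| ≤ δ)
    {x y : E} (hx : ‖x‖ ≤ 1) (hy : ‖y‖ ≤ 1) : |⟪g x, g y⟫ - ⟪x, y⟫| ≤ 11 / 2 * δ := by
  -- norms of `g x`, `g y`
  have hnx : |‖g x‖ - ‖x‖| ≤ δ := by
    have h := hg x 0 hx (by simp); rwa [hg0, sub_zero, sub_zero] at h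
  have hny : |‖g y‖ - ‖y‖| ≤ δ := by
    have h := hg y 0 hy (by simp); rwa [hg0, sub_zero, sub_zero] at h
  have hnxy := hg x y hx hy
  have hx2 : ‖g x‖ ≤ 2 := by have := (abs_le.1 hnx).2; linarith
  have hy2 : ‖g y‖ ≤ 2 := by have := (abs_le.1 hny).2; linarith
  have hxy2 : ‖x - y‖ ≤ 2 := (norm_sub_le x y).trans (by linarith)
  -- squares
  have hsx : |‖g x‖ ^ 2 - ‖x‖ ^ 2| ≤ 3 * δ := by
    rw [sq_sub_sq, abs_mul, abs_of_nonneg (by positivity : (0 : ℝ) ≤ ‖g x‖ + ‖x‖)]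
    calc (‖g x‖ + ‖x‖) * |‖g x‖ - ‖x‖| ≤ 3 * |‖g x‖ - ‖x‖| :=
          mul_le_mul_of_nonneg_right (by linarith) (abs_nonneg _)
      _ ≤ 3 * δ := by linarith
  have hsy : |‖g y‖ ^ 2 - ‖y‖ ^ 2| ≤ 3 * δ := by
    rw [sq_sub_sq, abs_mul, abs_of_nonneg (by positivity : (0 : ℝ) ≤ ‖g y‖ + ‖y‖)]
    calc (‖g y‖ + ‖y‖) * |‖g y‖ - ‖y‖| ≤ 3 * |‖g y‖ - ‖y‖| :=
          mul_le_mul_of_nonneg_right (by linarith) (abs_nonneg _)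
      _ ≤ 3 * δ := by linarith
  have hsxy : |‖g x - g y‖ ^ 2 - ‖x - y‖ ^ 2| ≤ 5 * δ := by
    have hgxy : ‖g x - g y‖ ≤ 3 := by have := (abs_le.1 hnxy).2; linarith
    rw [sq_sub_sq, abs_mul, abs_of_nonneg (by positivity : (0 : ℝ) ≤ ‖g x - g y‖ + ‖x - y‖)]
    calc (‖g x - g y‖ + ‖x - y‖) * |‖g x - g y‖ - ‖x - y‖| ≤ 5 * |‖g x - g y‖ - ‖x - y‖| :=
          mul_le_mul_of_nonneg_right (by linarith) (abs_nonneg _)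
      _ ≤ 5 * δ := by linarith
  -- polarization
  have hp1 : ⟪g x, g y⟫ = (‖g x‖ ^ 2 + ‖g y‖ ^ 2 - ‖g x - g y‖ ^ 2) / 2 := by
    have h := norm_sub_sq_real (g x) (g y)
    linarith
  have hp2 : ⟪x, y⟫ = (‖x‖ ^ 2 + ‖y‖ ^ 2 - ‖x - y‖ ^ 2) / 2 := by
    have h := norm_sub_sq_real x y
    linarith
  obtain ⟨h1a, h1b⟩ := abs_le.1 hsx
  obtain ⟨h2a, h2b⟩ := abs_le.1 hsy
  obtain ⟨h3a, h3b⟩ := abs_le.1 hsxy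
  rw [hp1, hp2, abs_le]
  constructor <;> linarith

/-- **Almost isometries of the Euclidean unit ball are close to isometries** (the folklore lemma
of Reifenberg-type arguments; Cheeger–Colding 1997, Appendix 1): if `f : ℝⁿ → ℝⁿ` satisfies
`|‖f x - f y‖ - ‖x - y‖| ≤ δ` for all `x, y` in the closed unit ball and
`δ ≤ 1/(12 (7n)ⁿ)`, then for some linear isometry `A` of `ℝⁿ`,
`‖f x - (f 0 + A x)‖ ≤ n (6 + 11 (7n)ⁿ) δ` on the closed unit ball.
[cite: CheegerColding1997, Appendix 1 (proof of Thm. A.1.2)] -/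
theorem exists_linearIsometryEquiv_near_of_abs_norm_sub_le (n : ℕ) {δ : ℝ}
    (f : EuclideanSpace ℝ (Fin n) → EuclideanSpace ℝ (Fin n)) (hδ0 : 0 ≤ δ)
    (hδ : δ ≤ 1 / (12 * (7 * n : ℝ) ^ n))
    (hf : ∀ x y : EuclideanSpace ℝ (Fin n), ‖x‖ ≤ 1 → ‖y‖ ≤ 1 → |‖f x - f y‖ - ‖x - y‖| ≤ δ) :
    ∃ A : EuclideanSpace ℝ (Fin n) ≃ₗᵢ[ℝ] EuclideanSpace ℝ (Fin n),
      ∀ x : EuclideanSpace ℝ (Fin n), ‖x‖ ≤ 1 →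
        ‖f x - (f 0 + A x)‖ ≤ n * (6 + 11 * (7 * n : ℝ) ^ n) * δ := by
  -- normalise `f 0 = 0`
  set g : EuclideanSpace ℝ (Fin n) → EuclideanSpace ℝ (Fin n) := fun x ↦ f x - f 0 with hg_def
  have hg0 : g 0 = 0 := by simp [hg_def]
  have hg : ∀ x y : EuclideanSpace ℝ (Fin n), ‖x‖ ≤ 1 → ‖y‖ ≤ 1 → |‖g x - g y‖ - ‖x - y‖| ≤ δ := fun x y hx hy ↦ by
    have : g x - g y = f x - f y := by simp only [hg_def]; abel
    rw [this]; exact hf x y hx hy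
  -- sizes
  have hNn : (1 : ℝ) ≤ (7 * n : ℝ) ^ n := by
    rcases Nat.eq_zero_or_pos n with h | h
    · subst h; simp
    · have h1 : (1 : ℝ) ≤ n := Nat.one_le_cast.2 h
      exact one_le_pow₀ (by linarith)
  have hδ1 : δ ≤ 1 := by
    have h1 : 1 / (12 * (7 * n : ℝ) ^ n) ≤ 1 := by
      rw [div_le_one (by positivity)]; linarith
    linarith
  have hgn : ∀ x : EuclideanSpace ℝ (Fin n), ‖x‖ ≤ 1 → ‖g x‖ ≤ 2 := fun x hx ↦ by
    have h := hg x 0 hx (by simp)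
    rw [hg0, sub_zero, sub_zero] at h
    have := (abs_le.1 h).2; linarith
  -- the standard frame `e i` and `u i = g(e i)`
  set bE : OrthonormalBasis (Fin n) ℝ (EuclideanSpace ℝ (Fin n)) := EuclideanSpace.basisFun (Fin n) ℝ
    with hbE
  set e : Fin n → EuclideanSpace ℝ (Fin n) := fun i ↦ bE i with he
  have hen : ∀ i, ‖e i‖ = 1 := fun i ↦ bE.orthonormal.1 i
  have hee : ∀ i j : Fin n, ⟪e i, e j⟫ = if i = j then 1 else 0 := fun i j ↦
    orthonormal_iff_ite.1 bE.orthonormal i j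
  have hxe : ∀ (x : EuclideanSpace ℝ (Fin n)) (i : Fin n), x i = ⟪e i, x⟫ := fun x i ↦ by
    rw [he, ← bE.repr_apply_apply x i, hbE, EuclideanSpace.basisFun_repr]
  set u : Fin n → EuclideanSpace ℝ (Fin n) := fun i ↦ g (e i) with hu
  have hpol : ∀ x y : EuclideanSpace ℝ (Fin n), ‖x‖ ≤ 1 → ‖y‖ ≤ 1 → |⟪g x, g y⟫ - ⟪x, y⟫| ≤ 11 / 2 * δ :=
    fun x y hx hy ↦ abs_inner_sub_inner_le_of_abs_norm_sub_le hδ1 hg0 hg hx hy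
  have hG : ∀ i j : Fin n, |⟪u i, u j⟫ - (if i = j then 1 else 0)| ≤ 11 / 2 * δ := fun i j ↦ by
    rw [← hee]; exact hpol (e i) (e j) (by rw [hen]) (by rw [hen])
  -- the orthonormal basis
  have hη : 11 / 2 * δ ≤ 1 / (2 * (7 * n : ℝ) ^ n) := by
    have h0 : 0 < (7 * n : ℝ) ^ n := by positivity
    calc 11 / 2 * δ ≤ 11 / 2 * (1 / (12 * (7 * n : ℝ) ^ n)) := mul_le_mul_of_nonneg_left hδ (by norm_num)
      _ = 11 / 24 * (1 / (7 * n : ℝ) ^ n) := by ring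
      _ ≤ 1 / 2 * (1 / (7 * n : ℝ) ^ n) := mul_le_mul_of_nonneg_right (by norm_num) (by positivity)
      _ = 1 / (2 * (7 * n : ℝ) ^ n) := by ring
  obtain ⟨b, hb⟩ := exists_orthonormalBasis_near (E := EuclideanSpace ℝ (Fin n)) (finrank_euclideanSpace_fin (𝕜 := ℝ) (n := n))
    u (by positivity) hη hG
  refine ⟨b.repr.symm, fun x hx ↦ ?_⟩
  -- `g x = Σ ⟪b i, g x⟫ b i`, `A x = Σ x i b i`
  have h1 : g x = ∑ i, ⟪b i, g x⟫ • b i := (b.sum_repr' (g x)).symm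
  have h2 : (b.repr.symm x : EuclideanSpace ℝ (Fin n)) = ∑ i, x i • b i := (b.sum_repr_symm x).symm
  have h3 : f x - (f 0 + b.repr.symm x) = ∑ i, (⟪b i, g x⟫ - x i) • b i := by
    rw [show f x - (f 0 + b.repr.symm x) = g x - b.repr.symm x by simp only [hg_def]; abel, h2]
    conv_lhs => rw [h1]
    rw [← Finset.sum_sub_distrib]
    refine Finset.sum_congr rfl fun i _ ↦ ?_
    rw [sub_smul]
  rw [h3]
  -- coordinatewise bound
  have hcoord : ∀ i, |⟪b i, g x⟫ - x i| ≤ (11 / 2 + 11 * (7 * n : ℝ) ^ n) * δ := by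
    intro i
    have hxi : x i = ⟪e i, x⟫ := hxe x i
    have h4 : ⟪b i, g x⟫ - x i = (⟪u i, g x⟫ - ⟪e i, x⟫) + ⟪b i - u i, g x⟫ := by
      have h7 : ⟪b i - u i, g x⟫ = ⟪b i, g x⟫ - ⟪u i, g x⟫ := inner_sub_left _ _ _
      rw [hxi, h7]; ring
    rw [h4]
    have h5 : |⟪u i, g x⟫ - ⟪e i, x⟫| ≤ 11 / 2 * δ := hpol (e i) x (by rw [hen]) hx
    have h6 : |⟪b i - u i, g x⟫| ≤ (7 * n : ℝ) ^ n * (11 / 2 * δ) * 2 :=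
      (abs_real_inner_le_norm _ _).trans (mul_le_mul (hb i) (hgn x hx) (norm_nonneg _) (by positivity))
    calc |⟪u i, g x⟫ - ⟪e i, x⟫ + ⟪b i - u i, g x⟫|
        ≤ |⟪u i, g x⟫ - ⟪e i, x⟫| + |⟪b i - u i, g x⟫| := abs_add_le _ _
      _ ≤ 11 / 2 * δ + (7 * n : ℝ) ^ n * (11 / 2 * δ) * 2 := add_le_add h5 h6
      _ = (11 / 2 + 11 * (7 * n : ℝ) ^ n) * δ := by ring
  calc ‖∑ i, (⟪b i, g x⟫ - x i) • b i‖ ≤ ∑ i, ‖(⟪b i, g x⟫ - x i) • b i‖ := norm_sum_le _ _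
    _ ≤ ∑ _i : Fin n, (11 / 2 + 11 * (7 * n : ℝ) ^ n) * δ := Finset.sum_le_sum fun i _ ↦ by
        rw [norm_smul, Real.norm_eq_abs, b.orthonormal.1 i, mul_one]; exact hcoord i
    _ = n * ((11 / 2 + 11 * (7 * n : ℝ) ^ n) * δ) := by
        rw [Finset.sum_const, Finset.card_univ, Fintype.card_fin, nsmul_eq_mul]
    _ ≤ n * (6 + 11 * (7 * n : ℝ) ^ n) * δ := by
        rw [mul_assoc]
        refine mul_le_mul_of_nonneg_left (mul_le_mul_of_nonneg_right (by linarith) hδ0) (by positivity)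

end NearIsometry

/-! ### §3 Scaled version and propagation of affine closeness -/

section Scaled

/-- **Scaled version**: a `δ`-almost isometry of the closed ball of radius `r > 0` of `ℝⁿ`,
`δ ≤ r/(12(7n)ⁿ)`, is within `n(6 + 11(7n)ⁿ) δ` of the affine isometry `f 0 + A x` there.
[cite: CheegerColding1997, Appendix 1 (proof of Thm. A.1.2)] -/
theorem exists_linearIsometryEquiv_near_of_abs_norm_sub_le_of_radius (n : ℕ) {δ r : ℝ} (hr : 0 < r)
    (f : EuclideanSpace ℝ (Fin n) → EuclideanSpace ℝ (Fin n)) (hδ0 : 0 ≤ δ)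
    (hδ : δ ≤ r / (12 * (7 * n : ℝ) ^ n))
    (hf : ∀ x y : EuclideanSpace ℝ (Fin n), ‖x‖ ≤ r → ‖y‖ ≤ r → |‖f x - f y‖ - ‖x - y‖| ≤ δ) :
    ∃ A : EuclideanSpace ℝ (Fin n) ≃ₗᵢ[ℝ] EuclideanSpace ℝ (Fin n),
      ∀ x : EuclideanSpace ℝ (Fin n), ‖x‖ ≤ r →
        ‖f x - (f 0 + A x)‖ ≤ n * (6 + 11 * (7 * n : ℝ) ^ n) * δ := by
  -- rescale to the unit ball: `F y = r⁻¹ f (r y)`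
  set F : EuclideanSpace ℝ (Fin n) → EuclideanSpace ℝ (Fin n) := fun y ↦ r⁻¹ • f (r • y) with hF_def
  have hF : ∀ x y : EuclideanSpace ℝ (Fin n), ‖x‖ ≤ 1 → ‖y‖ ≤ 1 →
      |‖F x - F y‖ - ‖x - y‖| ≤ δ / r := by
    intro x y hx hy
    have h1 : ‖r • x‖ ≤ r := by rw [norm_smul, Real.norm_eq_abs, abs_of_pos hr]; nlinarith
    have h2 : ‖r • y‖ ≤ r := by rw [norm_smul, Real.norm_eq_abs, abs_of_pos hr]; nlinarith
    have h := hf (r • x) (r • y) h1 h2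
    have h3 : ‖F x - F y‖ = r⁻¹ * ‖f (r • x) - f (r • y)‖ := by
      simp only [hF_def, ← smul_sub, norm_smul, Real.norm_eq_abs, abs_of_pos (inv_pos.2 hr)]
    have h4 : ‖x - y‖ = r⁻¹ * ‖r • x - r • y‖ := by
      rw [← smul_sub, norm_smul, Real.norm_eq_abs, abs_of_pos hr, ← mul_assoc, inv_mul_cancel₀ hr.ne',
        one_mul]
    rw [h3, h4, ← mul_sub, abs_mul, abs_of_pos (inv_pos.2 hr), div_eq_inv_mul]
    exact mul_le_mul_of_nonneg_left h (inv_pos.2 hr).le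
  have hδ' : δ / r ≤ 1 / (12 * (7 * n : ℝ) ^ n) := by
    rw [div_le_iff₀ hr]; simpa [div_eq_mul_inv, mul_comm] using hδ
  obtain ⟨A, hA⟩ := exists_linearIsometryEquiv_near_of_abs_norm_sub_le n F (div_nonneg hδ0 hr.le) hδ' hF
  refine ⟨A, fun x hx ↦ ?_⟩
  have hx' : ‖r⁻¹ • x‖ ≤ 1 := by
    rw [norm_smul, Real.norm_eq_abs, abs_of_pos (inv_pos.2 hr)]
    rw [inv_mul_le_iff₀ hr]; linarith
  have h := hA (r⁻¹ • x) hx'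
  have hF0 : F 0 = r⁻¹ • f 0 := by simp [hF_def]
  have hFx : F (r⁻¹ • x) = r⁻¹ • f x := by
    simp only [hF_def, smul_smul, mul_inv_cancel₀ hr.ne', one_smul]
  rw [hF0, hFx, map_smul, ← smul_add, ← smul_sub, norm_smul, Real.norm_eq_abs,
    abs_of_pos (inv_pos.2 hr)] at h
  rw [inv_mul_le_iff₀ hr] at h
  calc ‖f x - (f 0 + A x)‖ ≤ r * (n * (6 + 11 * (7 * n : ℝ) ^ n) * (δ / r)) := h
    _ = n * (6 + 11 * (7 * n : ℝ) ^ n) * δ := by field_simp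

/-- **Affine maps close on a ball are close everywhere, linearly in the radius**: if
`‖(a + L x) - (a' + L' x)‖ ≤ δ` for `‖x‖ ≤ r` (`r > 0`, `L, L'` linear), then for every `x`,
`‖(a + L x) - (a' + L' x)‖ ≤ δ (1 + 2‖x‖/r)`. (Consistency of overlapping Reifenberg charts.)
[folklore] -/
theorem norm_affine_sub_affine_le {F : Type*} [NormedAddCommGroup F] [NormedSpace ℝ F]
    {a a' : F} {L L' : E →ₗ[ℝ] F} {δ r : ℝ} (hr : 0 < r)
    (h : ∀ x : E, ‖x‖ ≤ r → ‖(a + L x) - (a' + L' x)‖ ≤ δ) (x : E) :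
    ‖(a + L x) - (a' + L' x)‖ ≤ δ * (1 + 2 * ‖x‖ / r) := by
  have h0 : ‖a - a'‖ ≤ δ := by simpa using h 0 (by simp; exact hr.le)
  have hδ0 : 0 ≤ δ := (norm_nonneg _).trans h0
  -- the linear parts differ by at most `2δ/r` in operator size
  have hlin : ‖L x - L' x‖ ≤ 2 * δ * ‖x‖ / r := by
    by_cases hx : x = 0
    · rw [hx, map_zero, map_zero, sub_zero, norm_zero, norm_zero]; positivity
    have hxn : 0 < ‖x‖ := norm_pos_iff.2 hx
    set c : ℝ := r / ‖x‖ with hc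
    have hc0 : 0 < c := div_pos hr hxn
    have hcx : ‖c • x‖ ≤ r := by
      rw [norm_smul, Real.norm_eq_abs, abs_of_pos hc0, hc, div_mul_cancel₀ r hxn.ne']
    have h1 := h (c • x) hcx
    have h2 : (a + L (c • x)) - (a' + L' (c • x)) = (a - a') + c • (L x - L' x) := by
      rw [map_smul, map_smul, smul_sub]; abel
    rw [h2] at h1
    have h3 : ‖c • (L x - L' x)‖ ≤ 2 * δ := by
      have h4 : c • (L x - L' x) = ((a - a') + c • (L x - L' x)) - (a - a') := by abel
      rw [h4]
      exact (norm_sub_le _ _).trans (by linarith)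
    rw [norm_smul, Real.norm_eq_abs, abs_of_pos hc0, hc] at h3
    rw [le_div_iff₀ hr]
    have h5 : r / ‖x‖ * ‖L x - L' x‖ * ‖x‖ = r * ‖L x - L' x‖ := by
      field_simp
    nlinarith [mul_le_mul_of_nonneg_right h3 hxn.le]
  calc ‖(a + L x) - (a' + L' x)‖ = ‖(a - a') + (L x - L' x)‖ := by congr 1; abel
    _ ≤ ‖a - a'‖ + ‖L x - L' x‖ := norm_add_le _ _
    _ ≤ δ + 2 * δ * ‖x‖ / r := add_le_add h0 hlin
    _ = δ * (1 + 2 * ‖x‖ / r) := by ring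

end Scaled

end Literature.Geometry.Euclidean

end
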